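import Summits.QuantumFields.YangMills.Theorems.PencilRigidityHypercubicLimitDefs
import Summits.QuantumFields.YangMills.Theorems.PencilRigidityHypercubicLimitDefsB
import Summits.QuantumFields.YangMills.Theorems.PencilRigidityHypercubicLimitRpBlockHermitian
import Summits.QuantumFields.YangMills.Theorems.PencilRigidityHypercubicLimitRpBlockReflectionPositive
import Summits.QuantumFields.YangMills.Theorems.PencilRigidityHypercubicLimitRpBlockPlaneWeightEq
import Summits.QuantumFields.YangMills.Theorems.PencilRigidityHypercubicLimitUniformBoundOfScaledShiftedBound
import HarnessLib

/-!
# Crux `HypercubicLimit` (stmt-QuantumFields-16154), line `peel-and-disseminate`: (R1) the RP-adapted lattice family of a scheme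

Route-vocabulary file (c3 seat, `--supports stmt-QuantumFields-16154`, registered sub-goal `softData_anti`) for
the piece (R1) `stub_reflHermRP` of the line — hermiticity and reflection positivity of the one-field limits of
the host closure (main file `MirrorModularBoostsHypercubicLimitPeelReflHermRP.lean`; analytic helpers
`MirrorModularBoostsHypercubicLimitPeelReflSlice.lean`; host vocabulary `SoftData`, `PolyRenorm`, `planeWeight` in
`PencilRigidityHypercubicLimitDefs(B).lean`, crux stmt-QuantumFields-8646).  NOTHING here is asserted: the four
`def`s name the objects of the route and every theorem is proved.
* §1 `rpDom`, `rpShift`, `rpFam`: **the RP-adapted lattice family** of a scheme at `(β, L, a, λ)` — plaquette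
  `(q, x)`, `q = (i, j)`, `i < j`, placed at its RP corner `a (x + (e_i + e_j − e₀)/2)`, temporal corners ranging
  over the box of half-side `L`, spatial ones over its time slab `[1−L, L]`, weights
  `λⁿ ∫ ∏ₖ (p_{qₖ}(xₖ) − ⟨p_{qₖ}⟩) dμ_{β,2L+1}`.  This is VERBATIM the family of the host blocks, so it is EXACTLY
  hermitian (`rpFam_isHermitian` ← `rpBlock_hermitian`) and EXACTLY reflection positive for `β ≥ 0`, `L ≥ 1`,
  `a > 0` (`rpFam_isReflectionPositive` ← `rpBlock_reflectionPositive`); against the plane-string weights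
  `W^{q} = planeWeight` (`rpBlock_planeWeightEq`) it unfolds as `rpFam n F = ∑_q λⁿ ∑_{x ∈ D_q} W^{q}(x) F(a x + c_q)`
  (`rpFam_apply`), with `D_q ⊆ box` (`rpDom_subset`), the complement on the far slice `x₀ = −L` (`rpDom_far`),
  `‖c_q‖ ≤ 2a` (`norm_rpShift_le`); `|W^{q}| ≤ (2N)ⁿ` (`abs_planeWeight_le_pow`), `W = 1, 0` at `n = 0, 1`
  (`planeWeight_zero`, `planeWeight_one`: exact centring), so `rpFam 0 = δ`, `rpFam 1 = 0` (`rpFam_zero`,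
  `rpFam_one`); `sum_piFinset_filter_eq` reindexes the plane expansion of `SoftData` over `{q // q.1 < q.2}ⁿ`.
* §2 `rhDemand m`: the torus demand of (R1), `Λ(β, k) = max 1 ⌈m(β)⁻²⌉` (`L ≥ a⁻²` for the boundary slice,
  `L ≥ 1` for odd-torus RP, units `a = m(β)`); `softData_anti`: `SoftData` is antitone in the demand (merges the
  demands of (R1)–(R3) in the line's composition `reflectionLegsP_of_pieces`).

Refs: OsterwalderSeiler1978 §§2–3 (lattice RP); OsterwalderSchrader1973 §§3–4; GlimmJaffe1987 §6.1;
`PencilRigidityHypercubicLimitDefs.lean` §7; `Cruxes/HypercubicLimit/CONSULT-c1-softdata.md`.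
-/

set_option autoImplicit false
noncomputable section
open scoped SchwartzMap ENNReal
open MeasureTheory Filter Topology
open Literature.MathematicalPhysics.AQFT Literature.MathematicalPhysics.QuantumLattice
open Literature.MathematicalPhysics.QuantumFieldTheory
open Literature.Probability.LatticeModels (box Site)
open Summit.QuantumFields.YangMills.Cruxes.HypercubicLimit.ConditionalMeanTelescoping
open Summit.QuantumFields.YangMills.Theorems.HypercubicLimit.Negative (torusPlaquette)
open Summit.QuantumFields.YangMills.Theorems.OSLegsFromFemtoAndGap (torusMomentStr latticeDistStr latticeDist)

namespace Summit.QuantumFields.YangMills.Cruxes.HypercubicLimit.PeelAndDisseminate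

/-! ## §1 The RP-adapted lattice family of the scheme -/

section RpFamily

variable {G : Type} [Group G] [TopologicalSpace G] [IsTopologicalGroup G] [CompactSpace G]
  [MeasurableSpace G] [BorelSpace G]

/-- The corner range of a plaquette of orientation `q` in the RP-adapted family on the torus of half-side
`L`: the box for temporal plaquettes, its time slab `[1-L, L]` for spatial ones. -/
def rpDom (L : ℕ) (q : {q : Fin 4 × Fin 4 // q.1 < q.2}) : Finset (Fin 4 → ℤ) :=
  if q.1.1 = 0 then box 4 L else (box 4 L).filter (fun y => 1 - (L : ℤ) ≤ y 0)

/-- The constant shift of the RP-adapted evaluation point of a plaquette of orientation `q = (i, j)` off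
the scaled corner: `a (e_i + e_j − e₀) / 2`. -/
def rpShift (a : ℝ) (q : {q : Fin 4 × Fin 4 // q.1 < q.2}) : EuclideanSpace ℝ (Fin 4) :=
  a • ((2⁻¹ : ℝ) • (EuclideanSpace.single q.1.1 (1 : ℝ) + EuclideanSpace.single q.1.2 (1 : ℝ) -
    EuclideanSpace.single 0 (1 : ℝ)))

/-- **The RP-adapted lattice family** at `(β, L, a, λ)`: plaquette `(q, x)` placed at its RP corner
`a (x + (e_i + e_j − e₀)/2)`, weights `λⁿ ∫ ∏ₖ (p_{qₖ}(xₖ) − ⟨p_{qₖ}⟩) dμ_{β,2L+1}` (verbatim the family of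
the host blocks `rpBlock_hermitian` / `rpBlock_reflectionPositive`, centred by the torus means). -/
def rpFam (r : LatticeRep G) (β : ℝ) (L : ℕ) (a lam : ℝ) : SchwingerFamily (EuclideanSpace ℝ (Fin 4)) :=
  fun n => ∑ q : Fin n → {q : Fin 4 × Fin 4 // q.1 < q.2},
    ∑ x ∈ Fintype.piFinset (fun k => if (q k).1.1 = 0 then box 4 L
        else (box 4 L).filter (fun y => 1 - (L : ℤ) ≤ y 0)),
      (((lam ^ n * ∫ U, ∏ k, (torusPlaquette r (2 * L + 1) (q k).1.1 (q k).1.2 (x k) U -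
          (fun q : {q : Fin 4 × Fin 4 // q.1 < q.2} => wilsonTorusMean r.ρ β L (planeObs r q.1)) (q k))
          ∂(wilsonMeasure r.ρ β : Measure (GaugeConfig 4 (2 * L + 1) G)) : ℝ) : ℂ)) •
        LabelledSchwingerFamily.evalAt (fun k => a • (siteToE (x k) +
          (2⁻¹ : ℝ) • (EuclideanSpace.single (q k).1.1 (1 : ℝ) + EuclideanSpace.single (q k).1.2 (1 : ℝ)
            - EuclideanSpace.single 0 (1 : ℝ))))

/-- The RP-adapted family is EXACTLY hermitian on every torus (host block `rpBlock_hermitian`). -/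
theorem rpFam_isHermitian (r : LatticeRep G) (β : ℝ) (L : ℕ) (a lam : ℝ) :
    (rpFam r β L a lam).toLabelled.IsHermitian :=
  rpBlock_hermitian G r β L a lam (fun q => wilsonTorusMean r.ρ β L (planeObs r q.1))

/-- The RP-adapted family is EXACTLY reflection positive for `β ≥ 0`, `L ≥ 1`, `a > 0` (host block
`rpBlock_reflectionPositive`). -/
theorem rpFam_isReflectionPositive (r : LatticeRep G) {β : ℝ} {L : ℕ} {a : ℝ} (lam : ℝ) (hβ : 0 ≤ β)
    (hL : 1 ≤ L) (ha : 0 < a) : (rpFam r β L a lam).toLabelled.IsReflectionPositive :=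
  rpBlock_reflectionPositive G r β L a lam (fun q => wilsonTorusMean r.ρ β L (planeObs r q.1)) hβ hL ha

/-- Unfolding the RP-adapted family against the plane-string weights `planeWeight`
(`rpBlock_planeWeightEq`): `rpFam n F = ∑_q λⁿ ∑_{x ∈ D_q} W^{q}(x) F(a x + c_q)`. -/
theorem rpFam_apply (r : LatticeRep G) (β : ℝ) (L : ℕ) (a lam : ℝ) (n : ℕ)
    (F : 𝓢((Fin n → EuclideanSpace ℝ (Fin 4)), ℂ)) :
    rpFam r β L a lam n F = ∑ q : Fin n → {q : Fin 4 × Fin 4 // q.1 < q.2}, ((lam ^ n : ℝ) : ℂ) *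
      ∑ x ∈ Fintype.piFinset (fun k => rpDom L (q k)),
        ((planeWeight r β L (fun i => (q i).1) x : ℝ) : ℂ) *
          F (fun l => a • siteToE (x l) + rpShift a (q l)) := by
  simp only [rpFam, _root_.sum_apply, _root_.smul_apply,
    LabelledSchwingerFamily.evalAt_apply, smul_eq_mul, Finset.mul_sum]
  refine Finset.sum_congr rfl fun q _ => Finset.sum_congr rfl fun x _ => ?_
  rw [rpBlock_planeWeightEq G r β L n (fun i => (q i).1) x]
  push_cast
  simp only [rpShift, smul_add, mul_assoc]

/-- The RP corner ranges lie in the box. -/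
theorem rpDom_subset (L : ℕ) {n : ℕ} (q : Fin n → {q : Fin 4 × Fin 4 // q.1 < q.2}) :
    Fintype.piFinset (fun k => rpDom L (q k)) ⊆ Fintype.piFinset (fun _ : Fin n => box 4 L) := by
  intro x hx
  rw [Fintype.mem_piFinset] at hx ⊢
  intro k
  have h := hx k
  unfold rpDom at h
  split_ifs at h with hq
  · exact h
  · exact (Finset.mem_filter.1 h).1

/-- A multi-index of the box outside the RP corner ranges has a corner on the far time slice `x₀ = -L`,
hence of sup norm `≥ L`. -/
theorem rpDom_far (L : ℕ) {n : ℕ} (q : Fin n → {q : Fin 4 × Fin 4 // q.1 < q.2})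
    (x : Fin n → Site 4) (hx : x ∈ Fintype.piFinset (fun _ : Fin n => box 4 L))
    (hxD : x ∉ Fintype.piFinset (fun k => rpDom L (q k))) : ∃ l, (L : ℝ) ≤ ‖x l‖ := by
  rw [Fintype.mem_piFinset] at hx hxD
  obtain ⟨l, hl⟩ := not_forall.1 hxD
  refine ⟨l, ?_⟩
  have hb := hx l
  unfold rpDom at hl
  split_ifs at hl with hq
  · exact absurd hb hl
  · have h0 : ¬ (1 - (L : ℤ) ≤ x l 0) := fun h => hl (Finset.mem_filter.2 ⟨hb, h⟩)
    have hlo := (Literature.Probability.LatticeModels.mem_box.1 hb 0).1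
    have hval : x l 0 = -(L : ℤ) := by omega
    have h1 : ‖x l 0‖ ≤ ‖x l‖ := norm_le_pi_norm (x l) 0
    rw [Int.norm_eq_abs, hval] at h1
    push_cast at h1
    rw [abs_neg, Nat.abs_cast] at h1
    exact h1

/-- The RP shifts are short: `‖c_q‖ ≤ 3a/2 ≤ 2a` (`a ≥ 0`). -/
theorem norm_rpShift_le {a : ℝ} (ha : 0 ≤ a) (q : {q : Fin 4 × Fin 4 // q.1 < q.2}) :
    ‖rpShift a q‖ ≤ 2 * a := by
  unfold rpShift
  rw [norm_smul, norm_smul, Real.norm_of_nonneg ha, Real.norm_of_nonneg (by norm_num : (0 : ℝ) ≤ 2⁻¹)]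
  have h : ‖EuclideanSpace.single q.1.1 (1 : ℝ) + EuclideanSpace.single q.1.2 (1 : ℝ) -
      EuclideanSpace.single (0 : Fin 4) (1 : ℝ)‖ ≤ 3 := by
    refine (norm_sub_le _ _).trans ?_
    refine (add_le_add (norm_add_le _ _) le_rfl).trans ?_
    simp only [EuclideanSpace.single, PiLp.norm_single, norm_one]
    norm_num
  nlinarith

/-- Sup bound of the plane-string weights: `|W^{q}(x)| ≤ (2 N_ρ)ⁿ` (unitarity). -/
theorem abs_planeWeight_le_pow (r : LatticeRep G) (β : ℝ) (L : ℕ) {n : ℕ} (q : Fin n → Fin 4 × Fin 4)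
    (x : Fin n → Site 4) : |planeWeight r β L q x| ≤ (2 * (r.N : ℝ)) ^ n := by
  rw [two_mul]
  exact abs_planeWeight_le r β L q x

/-- **Exact centring**: the one-point plane-string weights vanish. -/
theorem planeWeight_one (r : LatticeRep G) (β : ℝ) (L : ℕ) (q : Fin 1 → Fin 4 × Fin 4)
    (x : Fin 1 → Site 4) : planeWeight r β L q x = 0 := by
  haveI := isProbabilityMeasure_wilsonMeasure (d := 4) (L := 2 * L + 1) r.ρ r.continuous β
  rw [rpBlock_planeWeightEq G r β L 1 q x]
  simp only [Fin.prod_univ_one]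
  have hint : Integrable (fun U : GaugeConfig 4 (2 * L + 1) G =>
      torusPlaquette r (2 * L + 1) (q 0).1 (q 0).2 (x 0) U)
      (wilsonMeasure r.ρ β : Measure (GaugeConfig 4 (2 * L + 1) G)) :=
    Integrable.of_bound (C := (r.N : ℝ))
      (Theorems.HypercubicLimit.Negative.measurable_torusPlaquette r _ _ _ _).aestronglyMeasurable
      (ae_of_all _ fun U => by
        rw [Real.norm_eq_abs]
        exact abs_plaquetteObs_le_holds (ρ := r.ρ) r.mem_unitary (x 0) (q 0).1 (q 0).2 _)
  rw [integral_sub hint (integrable_const _), integral_const, probReal_univ, one_smul,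
    integral_torusPlaquette r β L (q 0) (x 0), sub_self]

/-- The zero-point plane-string weight is the total mass `1`. -/
theorem planeWeight_zero (r : LatticeRep G) (β : ℝ) (L : ℕ) (q : Fin 0 → Fin 4 × Fin 4)
    (x : Fin 0 → Site 4) : planeWeight r β L q x = 1 := by
  haveI := isProbabilityMeasure_wilsonMeasure (d := 4) (L := 2 * L + 1) r.ρ r.continuous β
  unfold planeWeight Summit.QuantumFields.YangMills.Theorems.OSLegsFromFemtoAndGap.torusMomentStr
  simp

/-- The RP-adapted zero-point distribution is `δ`. -/
theorem rpFam_zero (r : LatticeRep G) (β : ℝ) (L : ℕ) (a lam : ℝ)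
    (F : 𝓢((Fin 0 → EuclideanSpace ℝ (Fin 4)), ℂ)) : rpFam r β L a lam 0 F = F default := by
  rw [rpFam_apply]
  have h1 : ∀ q : Fin 0 → {q : Fin 4 × Fin 4 // q.1 < q.2},
      Fintype.piFinset (fun k => rpDom L (q k)) = {default} := fun q =>
    Finset.eq_singleton_iff_unique_mem.2
      ⟨Fintype.mem_piFinset.2 fun k => k.elim0, fun x _ => Subsingleton.elim _ _⟩
  simp only [Finset.univ_unique, Finset.sum_singleton, h1, pow_zero, Complex.ofReal_one, one_mul,
    planeWeight_zero]
  exact congrArg F (Subsingleton.elim _ _)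

/-- The RP-adapted one-point distribution vanishes (exact centring). -/
theorem rpFam_one (r : LatticeRep G) (β : ℝ) (L : ℕ) (a lam : ℝ)
    (F : 𝓢((Fin 1 → EuclideanSpace ℝ (Fin 4)), ℂ)) : rpFam r β L a lam 1 F = 0 := by
  rw [rpFam_apply]
  refine Finset.sum_eq_zero fun q _ => ?_
  rw [Finset.sum_eq_zero fun x _ => ?_, mul_zero]
  rw [planeWeight_one, Complex.ofReal_zero, zero_mul]

/-- Reindexing the plane expansion: orientation strings with `i < j` cornerwise are the strings of the
subtype `{q // q.1 < q.2}`. -/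
theorem sum_piFinset_filter_eq {M : Type*} [AddCommMonoid M] {n : ℕ} (f : (Fin n → Fin 4 × Fin 4) → M) :
    ∑ q ∈ Fintype.piFinset (fun _ : Fin n => Finset.univ.filter fun p : Fin 4 × Fin 4 => p.1 < p.2), f q =
      ∑ q : Fin n → {q : Fin 4 × Fin 4 // q.1 < q.2}, f (fun i => (q i).1) := by
  symm
  refine Finset.sum_nbij' (fun q i => (q i).1)
    (fun q' i => if h : (q' i).1 < (q' i).2 then ⟨q' i, h⟩ else ⟨((0 : Fin 4), (1 : Fin 4)), by decide⟩)
    ?_ ?_ ?_ ?_ ?_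
  · intro q _
    exact Fintype.mem_piFinset.2 fun i => Finset.mem_filter.2 ⟨Finset.mem_univ _, (q i).2⟩
  · intro q' _
    exact Finset.mem_univ _
  · intro q _
    funext i
    simp [(q i).2]
  · intro q' hq'
    funext i
    have h := (Finset.mem_filter.1 (Fintype.mem_piFinset.1 hq' i)).2
    simp [h]
  · intro q _
    rfl

end RpFamily

/-! ## §2 The torus demand of (R1) -/

/-- **The torus demand of (R1)**: `Λ(β, k) = max 1 ⌈m(β)⁻²⌉` (in units `a = m(β)`: `L ≥ a⁻²`, the far zone
of the boundary slice, and `L ≥ 1`, the odd-torus reflection positivity). -/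
def rhDemand (m : ℝ → ℝ) : ℝ → ℕ → ℕ := fun β _ => max 1 ⌈(m β)⁻¹ * (m β)⁻¹⌉₊

/-- `SoftData` is antitone in the torus demand (a witness for a larger demand is one for a smaller): the
demand enters `SoftData` only through `Λ (β_k) k ≤ L_k`. -/
theorem softData_anti :
    ∀ {G : Type} [Group G] [TopologicalSpace G] [IsTopologicalGroup G] [CompactSpace G] [MeasurableSpace G]
      [BorelSpace G] (r : LatticeRep G) (m : ℝ → ℝ) (δ₀ : ℝ) {Λ Λ' : ℝ → ℕ → ℕ}
      (sch : SpeciesScheme (YMSpecies G)) (S₁ : SchwingerFamily (EuclideanSpace ℝ (Fin 4)))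
      (Spl : (n : ℕ) → (Fin n → Fin 4 × Fin 4) → (𝓢((Fin n → EuclideanSpace ℝ (Fin 4)), ℂ) →L[ℂ] ℂ)),
      (∀ β k, Λ' β k ≤ Λ β k) → SoftData r m δ₀ Λ sch S₁ Spl → SoftData r m δ₀ Λ' sch S₁ Spl := by
  intro G _ _ _ _ _ _ r m δ₀ Λ Λ' sch S₁ Spl h hD
  exact ⟨hD.1, hD.2.1, fun k => (h _ _).trans (hD.2.2.1 k), hD.2.2.2⟩

end Summit.QuantumFields.YangMills.Cruxes.HypercubicLimit.PeelAndDisseminate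

end
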